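import Summits.NavierStokesRegularity.NavierStokesRegularity.Theorems.FilamentSkeletonRssKelvinGateRotationKernel

/-!
# Route `FilamentSkeletonRss` · crux `TransverseReductionRJ` (stmt-NavierStokesRegularity-21221) — line `kelvin_gate`,
# stub S2′ `EventualKelvinGate`: MAXIMUM PRINCIPLE for the linearised profile operator — the velocity part of
# `𝓛_(α,U⁰)` has trivial `C²` kernel vanishing at infinity whenever the base's compressive strain is `< ½`

Helper file (theorems only, `--supports stmt-NavierStokesRegularity-21221 --as helper`), vocabulary of
`FilamentSkeletonRssKelvinGateDefs` (`lerayLin`, `XBound`).  HONEST FRAMING: bookkeeping for a HYPOTHETICAL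
filament-type RSS blow-up route; nothing here bears on Navier–Stokes regularity; the stub is neither proved nor refuted.

This is the UNIQUENESS half of the "free gate" (item (1) of the S2′ architecture in the obstruction ledger, evidence
#25; hypothesis H1 of the rate-locking memo, evidence #26): for every rate `α` and every base `U⁰` whose compressive
strain is bounded by `θ < ½` (`⟪v, DU⁰(y) v⟫ ≥ −θ|v|²`; the free case `U⁰ = 0` has `θ = 0`), a `C²` field `W`
tending to `0` at infinity with `𝓛_(α,U⁰) W = 0` pointwise is identically zero.  Proof: maximum principle for `|W|²` —
at a global maximum `x₀` of `|W|²` one has `⟪W, DW[v]⟫ = 0` for every `v` (so the transport `½DW[y]`, rotation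
`−αDW[e₃ × y]` and convection `DW[U⁰]` terms drop out after pairing with `W(x₀)`), `⟪W, e₃ × W⟫ = 0` and
`⟪W, ΔW⟫ ≤ 0`, leaving `(½ − θ)|W(x₀)|² ≤ 0`.

What this is NOT: a statement with pressure (the Stokes-type kernel `𝓛W + ∇Q = 0`, `div W = 0` needs in addition
that bounded harmonic pressures are constant), nor a statement about the filament base (tube cores have strain `~Γ ≫ ½`;
there the rotation direction `𝓡₀U⋆` IS a kernel vector, `lerayLin_rotField_add_gradient_rotScalar`).  The pointwise
max-point conditions are the `C²` forms of `Literature.Analysis.FluidPDE.inner_fderiv_eq_zero_of_forall_norm_sq_le` /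
`inner_laplacian_nonpos_of_forall_norm_sq_le` (stated there for `C^∞`; proofs adapted).
-/

set_option linter.dupNamespace false

noncomputable section

namespace Summit.NavierStokesRegularity.NavierStokesRegularity.Theorems.KelvinGate

open Set Function Filter Metric
open Literature.Analysis.FluidPDE
open scoped InnerProductSpace RealInnerProductSpace Laplacian ContDiff Topology BigOperators

/-! ## 1. First- and second-order conditions at a global maximum of `|V|²` (`C¹` / `C²` versions) -/

/-- First-order condition at a global maximum `x₀` of `|V|²` for a differentiable field: `⟪V(x₀), DV(x₀) w⟫ = 0`.
(Adapted from `Literature.Analysis.FluidPDE.inner_fderiv_eq_zero_of_forall_norm_sq_le`, which assumes `C^∞`.) -/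
theorem inner_fderiv_eq_zero_of_isMax {V : EuclideanSpace ℝ (Fin 3) → EuclideanSpace ℝ (Fin 3)}
    (hV : Differentiable ℝ V) {x₀ : EuclideanSpace ℝ (Fin 3)} (hmax : ∀ x, ‖V x‖ ^ 2 ≤ ‖V x₀‖ ^ 2)
    (w : EuclideanSpace ℝ (Fin 3)) : ⟪V x₀, fderiv ℝ V x₀ w⟫ = 0 := by
  have hloc : IsLocalMax (fun x => ‖V x‖ ^ 2) x₀ := Filter.Eventually.of_forall hmax
  have hd := (hV x₀).hasFDerivAt.norm_sq
  have h0 := hloc.hasFDerivAt_eq_zero hd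
  have h1 := congrArg (fun L : EuclideanSpace ℝ (Fin 3) →L[ℝ] ℝ => L w) h0
  simpa using h1

/-- Second-order condition at a global maximum `x₀` of `|V|²` along a direction `e`, for a `C²` field:
`⟪V(x₀), D²V(x₀)[e, e]⟫ ≤ 0` (the function `s ↦ |V(x₀ + s e)|²` has a maximum at `0`, and its second derivative there
is `2|DV(x₀)e|² + 2⟪V(x₀), D²V(x₀)[e,e]⟫`).  (Adapted from
`Literature.Analysis.FluidPDE.inner_fderiv_fderiv_nonpos_of_forall_norm_sq_le`, which assumes `C^∞`.) -/
theorem inner_fderiv_fderiv_nonpos_of_isMax {V : EuclideanSpace ℝ (Fin 3) → EuclideanSpace ℝ (Fin 3)}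
    (hV : ContDiff ℝ 2 V) {x₀ : EuclideanSpace ℝ (Fin 3)} (hmax : ∀ x, ‖V x‖ ^ 2 ≤ ‖V x₀‖ ^ 2)
    (e : EuclideanSpace ℝ (Fin 3)) : ⟪V x₀, fderiv ℝ (fderiv ℝ V) x₀ e e⟫ ≤ 0 := by
  set P := fderiv ℝ V with hP
  set Q := fderiv ℝ P with hQ
  have hP1 : ContDiff ℝ 1 P := hV.fderiv_right (by norm_num)
  have hVd : ∀ y, HasFDerivAt V (P y) y := fun y => (hV.differentiable (by norm_num) y).hasFDerivAt
  have hPd : ∀ y, HasFDerivAt P (Q y) y := fun y => (hP1.differentiable (by norm_num) y).hasFDerivAt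
  -- the line `p s = x₀ + s e`
  let p : ℝ → EuclideanSpace ℝ (Fin 3) := fun s => x₀ + s • e
  have hp0 : p 0 = x₀ := by simp [p]
  have hpd : ∀ s, HasDerivAt p e s := fun s => by
    show HasDerivAt (fun s : ℝ => x₀ + s • e) e s
    simpa using ((hasDerivAt_id s).smul_const e).const_add x₀
  have hVp : ∀ s, HasDerivAt (fun s => V (p s)) (P (p s) e) s := fun s => by
    have := (hVd (p s)).comp_hasDerivAt s (hpd s)
    simpa [Function.comp_def] using this
  have hPp : ∀ s, HasDerivAt (fun s => P (p s) e) (Q (p s) e e) s := fun s => by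
    have h1 : HasDerivAt (fun s => P (p s)) (Q (p s) e) s := by
      have := (hPd (p s)).comp_hasDerivAt s (hpd s)
      simpa [Function.comp_def] using this
    have := h1.clm_apply (hasDerivAt_const s e)
    simpa using this
  -- `ℓ(s) = |V(p s)|²`
  set ℓ : ℝ → ℝ := fun s => ⟪V (p s), V (p s)⟫ with hℓ
  have hℓd : ∀ s, HasDerivAt ℓ (2 * ⟪V (p s), P (p s) e⟫) s := fun s => by
    refine ((hVp s).inner ℝ (hVp s)).congr_deriv ?_
    rw [real_inner_comm (P (p s) e), two_mul]
  have hderiv : deriv ℓ = fun s => 2 * ⟪V (p s), P (p s) e⟫ := funext fun s => (hℓd s).deriv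
  have hℓdd : ∀ s, HasDerivAt (fun s => 2 * ⟪V (p s), P (p s) e⟫)
      (2 * (⟪V (p s), Q (p s) e e⟫ + ⟪P (p s) e, P (p s) e⟫)) s := fun s =>
    ((hVp s).inner ℝ (hPp s)).const_mul 2
  have hderiv2 : deriv (deriv ℓ) 0 = 2 * (⟪V x₀, Q x₀ e e⟫ + ⟪P x₀ e, P x₀ e⟫) := by
    rw [hderiv, (hℓdd 0).deriv, hp0]
  have hderiv1 : deriv ℓ 0 = 0 := by
    rw [hderiv]
    simp only [hp0]
    rw [inner_fderiv_eq_zero_of_isMax (hV.differentiable (by norm_num)) hmax e, mul_zero]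
  have hℓmax : IsLocalMax ℓ 0 := Filter.Eventually.of_forall fun s => by
    simp only [hℓ, real_inner_self_eq_norm_sq, hp0]
    exact hmax _
  by_contra hcon
  push Not at hcon
  have hpos : deriv (deriv ℓ) 0 > 0 := by
    rw [hderiv2]
    have : 0 ≤ ⟪P x₀ e, P x₀ e⟫ := real_inner_self_nonneg
    linarith
  have hℓmin : IsLocalMin ℓ 0 := isLocalMin_of_deriv_deriv_pos hpos hderiv1 (hℓd 0).continuousAt
  have hconst : ∀ᶠ s in 𝓝 (0 : ℝ), ℓ s = ℓ 0 :=
    (hℓmin.and hℓmax).mono fun s hs => le_antisymm hs.2 hs.1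
  have hd0 : deriv ℓ =ᶠ[𝓝 (0 : ℝ)] fun _ => (0 : ℝ) := by
    filter_upwards [hconst.eventually_nhds] with s hs
    have h1 : ℓ =ᶠ[𝓝 s] fun _ => ℓ 0 := hs
    rw [h1.deriv_eq, deriv_const]
  have : deriv (deriv ℓ) 0 = 0 := by rw [hd0.deriv_eq, deriv_const]
  linarith

/-- At a global maximum `x₀` of `|V|²` for a `C²` field: `⟪V(x₀), ΔV(x₀)⟫ ≤ 0` (sum of the directional conditions over
the standard basis, `ΔV = Σ_i D²V[e_i, e_i]`). -/
theorem inner_laplacian_nonpos_of_isMax {V : EuclideanSpace ℝ (Fin 3) → EuclideanSpace ℝ (Fin 3)}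
    (hV : ContDiff ℝ 2 V) {x₀ : EuclideanSpace ℝ (Fin 3)} (hmax : ∀ x, ‖V x‖ ^ 2 ≤ ‖V x₀‖ ^ 2) :
    ⟪V x₀, (Δ V) x₀⟫ ≤ 0 := by
  rw [laplacian_eq_sum_fderiv_fderiv V, inner_sum]
  exact Finset.sum_nonpos fun i _ => inner_fderiv_fderiv_nonpos_of_isMax hV hmax _

/-! ## 2. Fields decaying at infinity attain the maximum of `|·|²` -/

/-- A continuous field which tends to `0` at infinity (`∀ η > 0, |W(x)| ≤ η` for `|x|` large) and is not identically
zero attains the global maximum of `|W|²`. -/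
theorem exists_forall_norm_sq_le {W : EuclideanSpace ℝ (Fin 3) → EuclideanSpace ℝ (Fin 3)} (hc : Continuous W)
    (hdec : ∀ η : ℝ, 0 < η → ∃ R : ℝ, ∀ x, R ≤ ‖x‖ → ‖W x‖ ≤ η)
    {x₁ : EuclideanSpace ℝ (Fin 3)} (hx₁ : W x₁ ≠ 0) :
    ∃ x₀, ∀ x, ‖W x‖ ^ 2 ≤ ‖W x₀‖ ^ 2 := by
  have hpos : 0 < ‖W x₁‖ := norm_pos_iff.mpr hx₁
  obtain ⟨R, hR⟩ := hdec (‖W x₁‖ / 2) (half_pos hpos)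
  have hx₁R : ‖x₁‖ < R := by
    by_contra h
    push Not at h
    have := hR x₁ h
    linarith
  obtain ⟨x₀, -, hx₀⟩ := (isCompact_closedBall (0 : EuclideanSpace ℝ (Fin 3)) R).exists_isMaxOn
    ⟨x₁, mem_closedBall_zero_iff.mpr hx₁R.le⟩ ((hc.norm.pow 2).continuousOn)
  refine ⟨x₀, fun x => ?_⟩
  have h2 : ‖W x₁‖ ^ 2 ≤ ‖W x₀‖ ^ 2 := hx₀ (mem_closedBall_zero_iff.mpr hx₁R.le)
  by_cases hx : ‖x‖ ≤ R
  · exact hx₀ (mem_closedBall_zero_iff.mpr hx)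
  · push Not at hx
    have h1 : ‖W x‖ ≤ ‖W x₁‖ / 2 := hR x hx.le
    have h0 : 0 ≤ ‖W x‖ := norm_nonneg _
    nlinarith

/-- An X-bounded field tends to `0` at infinity: `‖W x‖ ≤ R / (1 + ‖x‖)`. -/
theorem XBound.decay {W : EuclideanSpace ℝ (Fin 3) → EuclideanSpace ℝ (Fin 3)} {R : ℝ} (h : XBound W R) :
    ∀ η : ℝ, 0 < η → ∃ L : ℝ, ∀ x, L ≤ ‖x‖ → ‖W x‖ ≤ η := by
  intro η hη
  refine ⟨R / η, fun x hx => ?_⟩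
  have h1 : (1 + ‖x‖) * ‖W x‖ ≤ R := (h.2 x).1
  have hx0 : 0 ≤ ‖x‖ := norm_nonneg x
  have hR : R ≤ η * ‖x‖ := by
    have := (div_le_iff₀ hη).mp hx
    linarith [this]
  by_contra hcon
  push Not at hcon
  have : (1 + ‖x‖) * η < (1 + ‖x‖) * ‖W x‖ := mul_lt_mul_of_pos_left hcon (by linarith)
  nlinarith

/-! ## 3. The maximum principle for `𝓛_(α,U⁰)` (velocity part) -/

/-- `⟪w, e₃ × w⟫ = 0` (skewness of `e₃ × ·`). -/
theorem inner_cross_single_two_self (w : EuclideanSpace ℝ (Fin 3)) :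
    ⟪w, cross (EuclideanSpace.single 2 1) w⟫ = 0 := by
  rw [cross_single_two_eq_rotGenL]
  have h : ⟪w, rotGenL w⟫ = -⟪w, rotGenL w⟫ := by
    calc ⟪w, rotGenL w⟫ = ⟪rotGenL w, w⟫ := (real_inner_comm _ _).symm
      _ = -⟪w, rotGenL w⟫ := inner_rotGenL_left_eq_neg w w
  linarith

/-- **Maximum principle for the linearised profile operator (velocity part).**  Let `α` be any rate and `U⁰` a base
field whose COMPRESSIVE strain is bounded by `θ < ½`: `⟪v, DU⁰(y) v⟫ ≥ −θ |v|²` for all `y, v`.  If `W ∈ C²` tends to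
`0` at infinity and `𝓛_(α,U⁰) W = 0` pointwise (`lerayLin α U0 W y = 0`, no pressure term), then `W = 0`.
At a global maximum `x₀` of `|W|²`: pairing the equation with `W(x₀)` kills the transport, rotation-derivative and
convection terms (`⟪W, DW[v]⟫ = 0`), the rotation term `⟪W, e₃ × W⟫ = 0`, and leaves
`½|W|² + ⟪W, DU⁰W⟫ = ⟪W, ΔW⟫ ≤ 0`, i.e. `(½ − θ)|W(x₀)|² ≤ 0`. -/
theorem eq_zero_of_lerayLin_eq_zero (α : ℝ) {θ : ℝ} (hθ : θ < 1/2)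
    {U0 W : EuclideanSpace ℝ (Fin 3) → EuclideanSpace ℝ (Fin 3)} (hW : ContDiff ℝ 2 W)
    (hdec : ∀ η : ℝ, 0 < η → ∃ R : ℝ, ∀ x, R ≤ ‖x‖ → ‖W x‖ ≤ η)
    (hstrain : ∀ y v, -(θ * ‖v‖ ^ 2) ≤ ⟪v, fderiv ℝ U0 y v⟫)
    (heq : ∀ y, lerayLin α U0 W y = 0) : W = 0 := by
  by_contra hne
  obtain ⟨x₁, hx₁⟩ : ∃ x, W x ≠ 0 := by
    by_contra h
    push Not at h
    exact hne (funext h)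
  obtain ⟨x₀, hmax⟩ := exists_forall_norm_sq_le hW.continuous hdec hx₁
  have h1 : ∀ w, ⟪W x₀, fderiv ℝ W x₀ w⟫ = 0 :=
    inner_fderiv_eq_zero_of_isMax (hW.differentiable (by norm_num)) hmax
  have h2 : ⟪W x₀, (Δ W) x₀⟫ ≤ 0 := inner_laplacian_nonpos_of_isMax hW hmax
  have h3 : ⟪W x₀, cross (EuclideanSpace.single 2 1) (W x₀)⟫ = 0 := inner_cross_single_two_self _
  have key : ⟪W x₀, lerayLin α U0 W x₀⟫ = 0 := by rw [heq x₀, inner_zero_right]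
  simp only [lerayLin, inner_add_right, inner_sub_right, inner_smul_right, h1, h3, sub_zero, mul_zero, zero_add,
    add_zero, real_inner_self_eq_norm_sq] at key
  -- key : 1/2 * ‖W x₀‖² - ⟪W x₀, ΔW x₀⟫ + ⟪W x₀, DU0 x₀ (W x₀)⟫ = 0
  have h4 := hstrain x₀ (W x₀)
  have hpos : 0 < ‖W x₀‖ ^ 2 := by
    have := hmax x₁
    have h0 : 0 < ‖W x₁‖ ^ 2 := by positivity
    linarith
  nlinarith

/-- **The free linearised operator has trivial decaying `C²` kernel**: for every rate `α`, a `C²` field `W → 0` at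
infinity with `α(e₃ × W − DW[e₃ × y]) + ½W + ½DW[y] − ΔW = 0` pointwise vanishes identically (the case `U⁰ = 0`,
`θ = 0` of `eq_zero_of_lerayLin_eq_zero`) — the uniqueness half of the "free gate". -/
theorem eq_zero_of_lerayLin_zero_base_eq_zero (α : ℝ) {W : EuclideanSpace ℝ (Fin 3) → EuclideanSpace ℝ (Fin 3)}
    (hW : ContDiff ℝ 2 W) (hdec : ∀ η : ℝ, 0 < η → ∃ R : ℝ, ∀ x, R ≤ ‖x‖ → ‖W x‖ ≤ η)
    (heq : ∀ y, lerayLin α (fun _ => 0) W y = 0) : W = 0 := by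
  refine eq_zero_of_lerayLin_eq_zero α (θ := 0) (by norm_num) hW hdec (fun y v => ?_) heq
  simp

/-- **X-bounded form**: an X-bounded field in the kernel of the free linearised operator (velocity part) is zero. -/
theorem XBound.eq_zero_of_lerayLin_zero_base {W : EuclideanSpace ℝ (Fin 3) → EuclideanSpace ℝ (Fin 3)} {R : ℝ}
    (h : XBound W R) (α : ℝ) (heq : ∀ y, lerayLin α (fun _ => 0) W y = 0) : W = 0 :=
  eq_zero_of_lerayLin_zero_base_eq_zero α h.1 h.decay heq

/-- **X-bounded form around a base of small compressive strain** (`⟪v, DU⁰ v⟫ ≥ −θ|v|²`, `θ < ½`): an X-bounded field in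
the kernel of `𝓛_(α,U⁰)` (velocity part) is zero.  In particular the ROTATION DIRECTION `𝓡₀U⋆ ≠ 0` of an exact profile
(a kernel vector of the full operator WITH its pressure `𝓡ₛP⋆`, `lerayLin_rotField_add_gradient_rotScalar`) can be a
kernel vector of the velocity part alone only where the profile's compressive strain reaches `½`. -/
theorem XBound.eq_zero_of_lerayLin_eq_zero {U0 W : EuclideanSpace ℝ (Fin 3) → EuclideanSpace ℝ (Fin 3)} {R : ℝ}
    (h : XBound W R) (α : ℝ) {θ : ℝ} (hθ : θ < 1/2)
    (hstrain : ∀ y v, -(θ * ‖v‖ ^ 2) ≤ ⟪v, fderiv ℝ U0 y v⟫)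
    (heq : ∀ y, lerayLin α U0 W y = 0) : W = 0 :=
  KelvinGate.eq_zero_of_lerayLin_eq_zero α hθ h.1 h.decay hstrain heq

end Summit.NavierStokesRegularity.NavierStokesRegularity.Theorems.KelvinGate
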